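import Literature.Probability.LatticeModels.LatticeAnimalsGraph
import Mathlib.Data.Nat.Choose.Basic
import Mathlib.Data.Finset.Powerset
import Mathlib.Order.Interval.Finset.Nat
import Mathlib.Tactic.Ring
import Mathlib.Tactic.Linarith
import HarnessLib

/-!
# Counting connected sets through a vertex: the exploration (tree) bound `C((d-1)s+1, s-1)`

Companion of `LatticeAnimalsGraph` (`card_le_pow_of_isGraphConnected`: at most `Δ^{2(n-1)}` connected
`n`-sets through a vertex, by the closed-walk encoding of Friedli–Velenik Lemma 3.38). This file proves the
sharper EXPLORATION bound behind Fawzi–Grospellier–Leverrier 2018, Lemma 27 / Corollary 28 (the connected-set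
count of their `α`-percolation theorem, Thm 17; arXiv:1711.08351v2 §7.2, p0019): in a graph all of whose
degrees are `≤ d` (`d ≥ 1`), the number of connected vertex sets of cardinality `s` containing a fixed vertex
`v` is at most `C((d-1)s + 1, s-1)` — the number of `0/1`-strings of length `d + (d-1)(s-1)` with `s-1` ones.

Proof (ours; FGL quote instead the labelled-tree count of [Uehara 1999] / [Pah et al.], which gives the
slightly smaller `(d/((d-2)s+2))·C((d-1)s, s-1)` — both yield their Cor 28, `|𝒞_s(𝒢)| ≤ |V|·C((d-1)s, s)`,
after the symmetrisation `Σ_v |𝒞_s(v)| = s|𝒞_s(𝒢)|`, which is done where it is used): a breadth-first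
EXPLORATION of `X` from `v` along a fixed enumeration of each neighbourhood (`nbrList`, `ports`) writes, for
the `d` ports of `v` and for the `d-1` non-parent ports of every later vertex, one bit saying whether that
port discovers a new vertex of `X` (`chunk`, `encode`); the string determines `X` — the exploration can be
REPLAYED from it (`replay`, `replay_encode`) and discovers all of `X` when `X` is connected (`explore_spec`,
via the invariant `Inv` and cut-connectedness `seen_eq_of_closed`) — and it has length `d + (d-1)(s-1)` with
exactly `s-1` ones (`explore_spec`); the positions of the ones (`trueIdx`) give the injection into the
`(s-1)`-subsets of `range ((d-1)s+1)` (`card_le_choose_of_isGraphConnected`).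

Main statement: `TreeCount.card_le_choose_of_isGraphConnected` — for `1 ≤ d`, degrees `≤ d`, `v : V`, every
finite family of `G`-connected `s`-sets containing `v` has at most `((d-1)s+1).choose (s-1)` members. All
statements PROVED; the definitions (`sel`, `trueIdx`, `nbrList`, `ports`, `width`, `news`, `chunk`, `explore`,
`encode`, `replay`, `QAdj`, `Inv`) are the proof devices of this one count.

References: [cite: FawziGrospellierLeverrier2018, Lemma 27 / Cor 28 (§7.2, arXiv v2 p0019)];
[cite: FriedliVelenik2017, Lemma 3.38] (cut connectedness; the cruder walk bound of the companion file).
-/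

namespace Literature.Probability.LatticeModels

open Finset SimpleGraph

namespace TreeCount

variable {V : Type*}

/-! ### Bit-driven selection from a list of ports -/

/-- Select from the list of ports `ps` those whose bit is `true` (bits beyond the ports are ignored,
missing bits count as `false`). [cite: FawziGrospellierLeverrier2018, Lemma 27 proof (labelled spanning trees; §7.2, arXiv v2 p0019)] -/
def sel : List V → List Bool → List V
  | [], _ => []
  | _ :: _, [] => []
  | w :: ps, b :: bs => if b then w :: sel ps bs else sel ps bs

/-- Reading back the bits written from a predicate recovers the filter. [folklore] -/
private theorem sel_map_append (ps : List V) (f : V → Bool) (r : List Bool) :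
    sel ps (ps.map f ++ r) = ps.filter f := by
  induction ps with
  | nil => simp [sel]
  | cons w ps ih =>
    cases hf : f w
    · simp [sel, hf, ih]
    · simp [sel, hf, ih]

/-- Selected ports are ports. [folklore] -/
private theorem sel_sublist : ∀ (ps : List V) (bs : List Bool), (sel ps bs).Sublist ps
  | [], _ => by simp [sel]
  | _ :: _, [] => by simp [sel]
  | w :: ps, b :: bs => by
    by_cases hb : b
    · subst hb
      simp only [sel, if_true]
      exact (sel_sublist ps bs).cons_cons w
    · simp only [sel, hb]
      exact ((sel_sublist ps bs).cons w)

/-! ### Positions of the `true` bits -/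

/-- The set of positions (from the offset `i`) of the `true` bits of a list. [folklore] -/
def trueIdx : List Bool → ℕ → Finset ℕ
  | [], _ => ∅
  | b :: l, i => (if b then {i} else ∅) ∪ trueIdx l (i + 1)

/-- The positions lie in `[i, i + length)`. [folklore] -/
private theorem trueIdx_subset_Ico : ∀ (l : List Bool) (i : ℕ), trueIdx l i ⊆ Finset.Ico i (i + l.length)
  | [], i => by simp [trueIdx]
  | b :: l, i => by
    intro x hx
    simp only [trueIdx, Finset.mem_union] at hx
    rw [Finset.mem_Ico]
    rcases hx with hx | hx
    · by_cases hb : b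
      · subst hb; simp only [if_true, Finset.mem_singleton] at hx; subst hx; simp
      · simp [hb] at hx
    · have h := trueIdx_subset_Ico l (i + 1) hx
      rw [Finset.mem_Ico] at h
      simp only [List.length_cons]
      omega

/-- The offset itself is not a position of the tail. [folklore] -/
private theorem not_mem_trueIdx_succ (l : List Bool) (i : ℕ) : i ∉ trueIdx l (i + 1) := by
  intro h
  have := trueIdx_subset_Ico l (i + 1) h
  rw [Finset.mem_Ico] at this
  omega

/-- The number of positions is the number of `true` bits. [folklore] -/
private theorem card_trueIdx : ∀ (l : List Bool) (i : ℕ), (trueIdx l i).card = l.count true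
  | [], i => by simp [trueIdx]
  | b :: l, i => by
    cases b with
    | true =>
      have h1 : trueIdx (true :: l) i = {i} ∪ trueIdx l (i + 1) := by simp [trueIdx]
      rw [h1, Finset.card_union_of_disjoint (Finset.disjoint_singleton_left.2 (not_mem_trueIdx_succ l i)),
        Finset.card_singleton, card_trueIdx l (i + 1), List.count_cons_self]
      omega
    | false =>
      have h1 : trueIdx (false :: l) i = trueIdx l (i + 1) := by simp [trueIdx]
      rw [h1, card_trueIdx l (i + 1)]
      simp

/-- Lists of equal length with the same `true`-positions are equal. [folklore] -/
private theorem eq_of_trueIdx_eq : ∀ (l l' : List Bool) (i : ℕ), l.length = l'.length →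
    trueIdx l i = trueIdx l' i → l = l'
  | [], [], _, _, _ => rfl
  | [], _ :: _, _, h, _ => by simp at h
  | _ :: _, [], _, h, _ => by simp at h
  | b :: l, b' :: l', i, hlen, h => by
    have hmem : ∀ (c : Bool) (m : List Bool), (i ∈ trueIdx (c :: m) i ↔ c = true) := by
      intro c m
      cases c <;> simp [trueIdx, not_mem_trueIdx_succ]
    have hbb : b = b' := by
      have h1 := hmem b l
      have h2 := hmem b' l'
      rw [h] at h1
      cases b <;> cases b' <;> simp_all
    subst hbb
    have htail : trueIdx l (i + 1) = trueIdx l' (i + 1) := by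
      ext x
      by_cases hx : x = i
      · subst hx
        simp [not_mem_trueIdx_succ]
      · have hx1 : x ∈ trueIdx (b :: l) i ↔ x ∈ trueIdx (b :: l') i := by rw [h]
        cases b with
        | false =>
          simp only [trueIdx, Bool.false_eq_true, ↓reduceIte, Finset.empty_union] at hx1
          exact hx1
        | true =>
          simp only [trueIdx, ↓reduceIte, Finset.mem_union, Finset.mem_singleton, hx, false_or] at hx1
          exact hx1
    rw [eq_of_trueIdx_eq l l' (i + 1) (by simpa using hlen) htail]

/-! ### The exploration of a vertex set along fixed neighbourhood enumerations -/

variable [DecidableEq V] (G : SimpleGraph V) [Fintype V] [DecidableRel G.Adj]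

/-- A fixed enumeration of the neighbourhood of `u` (its "ports"). [cite: FawziGrospellierLeverrier2018, Lemma 27 proof ("the directed edges whose head is some node v are injectively labeled"; §7.2, arXiv v2 p0019)] -/
noncomputable def nbrList (u : V) : List V := (G.neighborFinset u).toList

/-- The ports of `u` scanned by the exploration: all of them at the root (`none`), all but the parent
port otherwise. [cite: FawziGrospellierLeverrier2018, Lemma 27 proof (root: labels in ⟦1;d⟧, other nodes: ⟦1;d-1⟧; §7.2, arXiv v2 p0019)] -/
noncomputable def ports (u : V) : Option V → List V
  | none => nbrList G u
  | some p => (nbrList G u).erase p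

/-- The number of bits written for a vertex: `d` at the root, `d - 1` elsewhere. [cite: FawziGrospellierLeverrier2018, Lemma 27 proof (§7.2, arXiv v2 p0019)] -/
def width (d : ℕ) : Option V → ℕ
  | none => d
  | some _ => d - 1

/-- The vertices of `X` newly discovered when `u` (with parent `p`) is processed at the discovered
set `seen`, in port order. [folklore] -/
noncomputable def news (X : Finset V) (u : V) (p : Option V) (seen : Finset V) : List V :=
  (ports G u p).filter fun w => decide (w ∈ X ∧ w ∉ seen)

/-- The bits written when `u` is processed: one per port (does it discover a new vertex of `X`?),
padded with `false` to the fixed width. [folklore] -/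
noncomputable def chunk (d : ℕ) (X : Finset V) (u : V) (p : Option V) (seen : Finset V) : List Bool :=
  (ports G u p).map (fun w => decide (w ∈ X ∧ w ∉ seen)) ++
    List.replicate (width d p - (ports G u p).length) false

/-- The exploration of `X` (fuel `n`, queue of (vertex, parent), discovered set): its final discovered
set. [folklore] -/
noncomputable def explore (X : Finset V) : ℕ → List (V × Option V) → Finset V → Finset V
  | 0, _, seen => seen
  | _ + 1, [], seen => seen
  | n + 1, (u, p) :: q, seen =>
      explore X n (q ++ (news G X u p seen).map fun w => (w, some u))
        (seen ∪ (news G X u p seen).toFinset)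

/-- The code of `X`: the concatenation of the chunks written along the exploration. [folklore] -/
noncomputable def encode (d : ℕ) (X : Finset V) : ℕ → List (V × Option V) → Finset V → List Bool
  | 0, _, _ => []
  | _ + 1, [], _ => []
  | n + 1, (u, p) :: q, seen =>
      chunk G d X u p seen ++
        encode d X n (q ++ (news G X u p seen).map fun w => (w, some u))
          (seen ∪ (news G X u p seen).toFinset)

/-- Replaying a bit string: the same exploration, with the discoveries READ from the string instead
of from `X`. [folklore] -/
noncomputable def replay (d : ℕ) : ℕ → List (V × Option V) → Finset V → List Bool → Finset V
  | 0, _, seen, _ => seen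
  | _ + 1, [], seen, _ => seen
  | n + 1, (u, p) :: q, seen, bits =>
      replay d n (q ++ (sel (ports G u p) bits).map fun w => (w, some u))
        (seen ∪ (sel (ports G u p) bits).toFinset) (bits.drop (width d p))

variable {G}

/-- Ports are neighbours. [folklore] -/
private theorem adj_of_mem_ports {u : V} {p : Option V} {w : V} (h : w ∈ ports G u p) : G.Adj u w := by
  have h' : w ∈ nbrList G u := by
    cases p with
    | none => exact h
    | some p => exact List.mem_of_mem_erase h
  rw [nbrList, Finset.mem_toList, SimpleGraph.mem_neighborFinset] at h'
  exact h'

/-- The port lists have no duplicates. [folklore] -/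
private theorem nodup_ports (u : V) (p : Option V) : (ports G u p).Nodup := by
  cases p with
  | none => exact Finset.nodup_toList _
  | some p => exact (Finset.nodup_toList _).erase p

/-- The number of ports is at most the width (degrees `≤ d`; the parent is a neighbour). [folklore] -/
private theorem length_ports_le {d : ℕ} (hdeg : ∀ x, G.degree x ≤ d) (u : V) :
    ∀ (p : Option V), (∀ p₀, p = some p₀ → G.Adj u p₀) → (ports G u p).length ≤ width d p
  | none, _ => by
    show (nbrList G u).length ≤ d
    rw [nbrList, Finset.length_toList, SimpleGraph.card_neighborFinset_eq_degree]
    exact hdeg u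
  | some p₀, hp => by
    have hmem : p₀ ∈ nbrList G u := by
      rw [nbrList, Finset.mem_toList, SimpleGraph.mem_neighborFinset]; exact hp p₀ rfl
    show ((nbrList G u).erase p₀).length ≤ d - 1
    rw [List.length_erase_of_mem hmem, nbrList, Finset.length_toList,
      SimpleGraph.card_neighborFinset_eq_degree]
    exact Nat.sub_le_sub_right (hdeg u) 1

/-- The chunk has exactly the width (when the ports fit). [folklore] -/
private theorem length_chunk {d : ℕ} {X : Finset V} {u : V} {p : Option V} {seen : Finset V}
    (h : (ports G u p).length ≤ width d p) : (chunk G d X u p seen).length = width d p := by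
  simp only [chunk, List.length_append, List.length_map, List.length_replicate]
  omega

/-- The number of `true` bits of a chunk is the number of discoveries. [folklore] -/
private theorem count_chunk (d : ℕ) (X : Finset V) (u : V) (p : Option V) (seen : Finset V) :
    (chunk G d X u p seen).count true = (news G X u p seen).length := by
  rw [chunk, news, List.count_append]
  have h0 : (List.replicate (width d p - (ports G u p).length) false).count true = 0 := by
    simp [List.count_replicate]
  rw [h0, add_zero, List.count_eq_countP, List.countP_map, List.countP_eq_length_filter]
  congr 1
  apply List.filter_congr
  intro w _
  simp

/-- Replaying the bits of a chunk selects exactly the discoveries. [folklore] -/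
private theorem sel_chunk_append (d : ℕ) (X : Finset V) (u : V) (p : Option V) (seen : Finset V) (r : List Bool) :
    sel (ports G u p) (chunk G d X u p seen ++ r) = news G X u p seen := by
  rw [chunk, List.append_assoc, sel_map_append]
  rfl

/-- Dropping a prefix of its own length. [folklore] -/
private theorem drop_length_append' {α : Type*} (l₁ l₂ : List α) : (l₁ ++ l₂).drop l₁.length = l₂ := by
  induction l₁ with
  | nil => rfl
  | cons a l ih => simp [ih]

/-- The queue discipline: every non-root entry records an ADJACENT parent. [folklore] -/
private def QAdj (Q : List (V × Option V)) : Prop := ∀ e ∈ Q, ∀ p₀, e.2 = some p₀ → G.Adj e.1 p₀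

omit [Fintype V] [DecidableRel G.Adj] in
/-- The queue discipline propagates to the new entries `(w, some u)`, `w` a port of `u`. [folklore] -/
private theorem qAdj_step {u : V} {p : Option V} {q : List (V × Option V)} {ws : List V}
    [Fintype V] [DecidableRel G.Adj]
    (hQ : QAdj (G := G) ((u, p) :: q)) (hws : ∀ w ∈ ws, w ∈ ports G u p) :
    QAdj (G := G) (q ++ ws.map fun w => (w, some u)) := by
  intro e he p₀ hp₀
  rcases List.mem_append.1 he with he | he
  · exact hQ e (List.mem_cons_of_mem _ he) p₀ hp₀
  · obtain ⟨w, hw, rfl⟩ := List.mem_map.1 he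
    simp only [Option.some.injEq] at hp₀
    subst hp₀
    exact (adj_of_mem_ports (hws w hw)).symm

/-- **Simulation**: replaying the code of `X` (followed by anything) from a state with the queue
discipline reproduces the exploration of `X`. [cite: FawziGrospellierLeverrier2018, Lemma 27 proof ("we then get a labelled rooted tree … by fixing the labelling"; §7.2, arXiv v2 p0019)] -/
private theorem replay_encode {d : ℕ} (hdeg : ∀ x, G.degree x ≤ d) (X : Finset V) :
    ∀ (n : ℕ) (Q : List (V × Option V)) (seen : Finset V) (r : List Bool), QAdj (G := G) Q →
      replay G d n Q seen (encode G d X n Q seen ++ r) = explore G X n Q seen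
  | 0, Q, seen, r, _ => by simp [replay, explore]
  | n + 1, [], seen, r, _ => by simp [replay, explore]
  | n + 1, (u, p) :: q, seen, r, hQ => by
    have hports : (ports G u p).length ≤ width d p :=
      length_ports_le hdeg u p (hQ (u, p) List.mem_cons_self)
    have hnews : ∀ w ∈ news G X u p seen, w ∈ ports G u p := fun w hw => List.mem_of_mem_filter hw
    simp only [encode, replay, explore, List.append_assoc]
    rw [sel_chunk_append, ← length_chunk (X := X) (seen := seen) hports, drop_length_append']
    exact replay_encode hdeg X n _ _ r (qAdj_step hQ hnews)

/-! ### The exploration of a connected set discovers all of it -/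

/-- The invariant of the exploration of `X` from `v`: discovered vertices are in `X`, `v` is discovered,
queued vertices are discovered and pairwise distinct, processed (= discovered, not queued) vertices have
all their `X`-neighbours discovered, and recorded parents are discovered neighbours. [folklore] -/
private structure Inv (X : Finset V) (v : V) (Q : List (V × Option V)) (seen : Finset V) : Prop where
  sub : seen ⊆ X
  root : v ∈ seen
  qmem : ∀ e ∈ Q, e.1 ∈ seen
  nodup : (Q.map Prod.fst).Nodup
  closed : ∀ x ∈ seen, x ∉ Q.map Prod.fst → ∀ y, G.Adj x y → y ∈ X → y ∈ seen
  parent : ∀ e ∈ Q, ∀ p₀, e.2 = some p₀ → p₀ ∈ seen ∧ G.Adj e.1 p₀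

omit [DecidableEq V] [Fintype V] [DecidableRel G.Adj] in
/-- The invariant holds initially. [folklore] -/
private theorem inv_init {X : Finset V} {v : V} (hv : v ∈ X) :
    Inv (G := G) X v [(v, none)] {v} where
  sub := by simpa using hv
  root := Finset.mem_singleton_self v
  qmem := by simp
  nodup := by simp
  closed := by
    intro x hx hxq
    simp only [List.map_cons, List.map_nil, List.mem_singleton, Finset.mem_singleton] at hx hxq
    exact absurd hx hxq
  parent := by simp

omit [Fintype V] [DecidableRel G.Adj] in
/-- A closed discovered set containing `v` inside a connected `X` is all of `X` (cut connectedness with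
the part `seen`). [cite: FriedliVelenik2017, Lemma 3.38] -/
theorem seen_eq_of_closed {X : Finset V} {v : V} (hconn : IsGraphConnected G X) {seen : Finset V}
    (hsub : seen ⊆ X) (hv : v ∈ seen) (hclosed : ∀ x ∈ seen, ∀ y, G.Adj x y → y ∈ X → y ∈ seen) :
    seen = X := by
  refine Finset.Subset.antisymm hsub ?_
  by_contra hnot
  have hne : (X \ seen).Nonempty := by
    rw [Finset.sdiff_nonempty]; exact hnot
  obtain ⟨a, ha, b, hb, hab⟩ := hconn seen hsub ⟨v, hv⟩ hne
  rw [Finset.mem_sdiff] at hb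
  exact hb.2 (hclosed a ha b hab hb.1)

/-- The discoveries are new, in `X`, and pairwise distinct. [folklore] -/
private theorem news_facts (X : Finset V) (u : V) (p : Option V) (seen : Finset V) :
    (∀ w ∈ news G X u p seen, w ∈ X ∧ w ∉ seen ∧ w ∈ ports G u p) ∧ (news G X u p seen).Nodup := by
  refine ⟨fun w hw => ?_, (nodup_ports u p).filter _⟩
  rw [news, List.mem_filter] at hw
  have h := of_decide_eq_true hw.2
  exact ⟨h.1, h.2, hw.1⟩

/-- One step of the exploration preserves the invariant. [folklore] -/
private theorem inv_step {X : Finset V} {v u : V} {p : Option V} {q : List (V × Option V)} {seen : Finset V}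
    (h : Inv (G := G) X v ((u, p) :: q) seen) :
    Inv (G := G) X v (q ++ (news G X u p seen).map fun w => (w, some u))
      (seen ∪ (news G X u p seen).toFinset) := by
  obtain ⟨hnews, hnodup⟩ := news_facts (G := G) X u p seen
  have hu : u ∈ seen := h.qmem (u, p) List.mem_cons_self
  have hmapfst : (q ++ (news G X u p seen).map fun w => (w, some u)).map Prod.fst
      = q.map Prod.fst ++ news G X u p seen := by
    simp [List.map_append, Function.comp_def]
  refine ⟨?_, ?_, ?_, ?_, ?_, ?_⟩
  · -- sub
    intro x hx
    rcases Finset.mem_union.1 hx with hx | hx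
    · exact h.sub hx
    · exact (hnews x (List.mem_toFinset.1 hx)).1
  · exact Finset.mem_union_left _ h.root
  · -- qmem
    intro e he
    rcases List.mem_append.1 he with he | he
    · exact Finset.mem_union_left _ (h.qmem e (List.mem_cons_of_mem _ he))
    · obtain ⟨w, hw, rfl⟩ := List.mem_map.1 he
      exact Finset.mem_union_right _ (List.mem_toFinset.2 hw)
  · -- nodup
    rw [hmapfst]
    have hq : (q.map Prod.fst).Nodup := by
      have := h.nodup
      rw [List.map_cons, List.nodup_cons] at this
      exact this.2
    refine List.Nodup.append hq hnodup ?_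
    intro x hxq hxn
    have hxseen : x ∈ seen := by
      obtain ⟨e, he, rfl⟩ := List.mem_map.1 hxq
      exact h.qmem e (List.mem_cons_of_mem _ he)
    exact (hnews x hxn).2.1 hxseen
  · -- closed
    intro x hx hxQ y hxy hyX
    rw [hmapfst, List.mem_append, not_or] at hxQ
    rcases Finset.mem_union.1 hx with hxs | hxn
    · by_cases hxu : x = u
      · subst hxu
        -- a neighbour `y ∈ X` of the vertex just processed
        by_cases hys : y ∈ seen
        · exact Finset.mem_union_left _ hys
        · refine Finset.mem_union_right _ (List.mem_toFinset.2 ?_)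
          rw [news, List.mem_filter]
          refine ⟨?_, decide_eq_true ⟨hyX, hys⟩⟩
          have hyn : y ∈ nbrList G x := by
            rw [nbrList, Finset.mem_toList, SimpleGraph.mem_neighborFinset]; exact hxy
          cases hp : p with
          | none => simpa [ports] using hyn
          | some p₀ =>
            have hp₀ : p₀ ∈ seen := (h.parent (x, p) List.mem_cons_self p₀ hp).1
            have hne : y ≠ p₀ := fun hyp => hys (hyp ▸ hp₀)
            simpa [ports] using (List.mem_erase_of_ne hne).2 hyn
      · have hxold : x ∉ ((u, p) :: q).map Prod.fst := by
          rw [List.map_cons, List.mem_cons, not_or]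
          exact ⟨hxu, hxQ.1⟩
        exact Finset.mem_union_left _ (h.closed x hxs hxold y hxy hyX)
    · exact absurd (List.mem_toFinset.1 hxn) hxQ.2
  · -- parent
    intro e he p₀ hp₀
    rcases List.mem_append.1 he with he | he
    · obtain ⟨h1, h2⟩ := h.parent e (List.mem_cons_of_mem _ he) p₀ hp₀
      exact ⟨Finset.mem_union_left _ h1, h2⟩
    · obtain ⟨w, hw, rfl⟩ := List.mem_map.1 he
      simp only [Option.some.injEq] at hp₀
      subst hp₀
      exact ⟨Finset.mem_union_left _ hu, (adj_of_mem_ports (hnews w hw).2.2).symm⟩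

/-- The potential `|X| + |Q| - |seen|` drops by one per step: the new discovered set has
`|seen| + #news` elements. [folklore] -/
private theorem card_seen_step (X : Finset V) (u : V) (p : Option V) (seen : Finset V) :
    (seen ∪ (news G X u p seen).toFinset).card = seen.card + (news G X u p seen).length := by
  obtain ⟨hnews, hnodup⟩ := news_facts (G := G) X u p seen
  rw [Finset.card_union_of_disjoint, List.toFinset_card_of_nodup hnodup]
  rw [Finset.disjoint_left]
  intro x hx hxn
  exact (hnews x (List.mem_toFinset.1 hxn)).2.1 hx

omit [Fintype V] [DecidableRel G.Adj] in
/-- Under the invariant the queue is no longer than the discovered set. [folklore] -/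
private theorem length_le_card_of_inv {X : Finset V} {v : V} {Q : List (V × Option V)} {seen : Finset V}
    (h : Inv (G := G) X v Q seen) : Q.length ≤ seen.card := by
  have h1 : (Q.map Prod.fst).toFinset ⊆ seen := by
    intro x hx
    obtain ⟨e, he, rfl⟩ := List.mem_map.1 (List.mem_toFinset.1 hx)
    exact h.qmem e he
  calc Q.length = (Q.map Prod.fst).length := by simp
    _ = (Q.map Prod.fst).toFinset.card := (List.toFinset_card_of_nodup h.nodup).symm
    _ ≤ seen.card := Finset.card_le_card h1

/-- **The exploration of a connected set from one of its vertices discovers exactly the set**, and the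
code written along the way has length `Σ_{queue} width + (d-1)·(#undiscovered)` and one `true` bit per
undiscovered vertex — from any state satisfying the invariant, with fuel at least the potential
`|X| + |Q| - |seen|`. [cite: FawziGrospellierLeverrier2018, Lemma 27 proof (spanning tree of X rooted at v; §7.2, arXiv v2 p0019)] -/
private theorem explore_spec {X : Finset V} {v : V} (hconn : IsGraphConnected G X) {d : ℕ}
    (hdeg : ∀ x, G.degree x ≤ d) :
    ∀ (n : ℕ) (Q : List (V × Option V)) (seen : Finset V), Inv (G := G) X v Q seen →
      X.card + Q.length ≤ n + seen.card →
      explore G X n Q seen = X ∧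
        (encode G d X n Q seen).length + (d - 1) * seen.card
          = (Q.map fun e => width d e.2).sum + (d - 1) * X.card ∧
        (encode G d X n Q seen).count true + seen.card = X.card
  | 0, Q, seen, h, hφ => by
    have hXs : seen.card ≤ X.card := Finset.card_le_card h.sub
    have hQ : Q = [] := by
      have : Q.length = 0 := by omega
      exact List.eq_nil_of_length_eq_zero this
    subst hQ
    have hX : seen = X :=
      seen_eq_of_closed hconn h.sub h.root fun x hx y hxy hyX => h.closed x hx (by simp) y hxy hyX
    subst hX
    simp [explore, encode]
  | n + 1, [], seen, h, hφ => by
    have hX : seen = X :=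
      seen_eq_of_closed hconn h.sub h.root fun x hx y hxy hyX => h.closed x hx (by simp) y hxy hyX
    subst hX
    simp [explore, encode]
  | n + 1, (u, p) :: q, seen, h, hφ => by
    have h' := inv_step h
    have hcard := card_seen_step (G := G) X u p seen
    have hφ' : X.card + (q ++ (news G X u p seen).map fun w => (w, some u)).length
        ≤ n + (seen ∪ (news G X u p seen).toFinset).card := by
      rw [hcard, List.length_append, List.length_map]
      simp only [List.length_cons] at hφ
      omega
    obtain ⟨ih1, ih2, ih3⟩ := explore_spec hconn hdeg n _ _ h' hφ'
    have hports : (ports G u p).length ≤ width d p :=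
      length_ports_le hdeg u p (fun p₀ hp₀ => (h.parent (u, p) List.mem_cons_self p₀ hp₀).2)
    have hsum : ((q ++ (news G X u p seen).map fun w => (w, some u)).map fun e => width d e.2).sum
        = (q.map fun e => width d e.2).sum + (news G X u p seen).length * (d - 1) := by
      rw [List.map_append, List.sum_append, List.map_map]
      congr 1
      have hc : ((fun e : V × Option V => width d e.2) ∘ fun w => (w, some u)) = fun _ => d - 1 := by
        funext w; rfl
      rw [hc, List.map_const', List.sum_replicate, smul_eq_mul]
    refine ⟨?_, ?_, ?_⟩
    · simpa [explore] using ih1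
    · simp only [encode, List.length_append, List.map_cons, List.sum_cons, length_chunk hports]
      rw [hcard, hsum] at ih2
      have h2 := ih2
      ring_nf at h2 ⊢
      linarith
    · simp only [encode, List.count_append, count_chunk]
      rw [hcard] at ih3
      omega

/-! ### The count -/

/-- **Connected sets through a vertex: the exploration bound.** In a graph all of whose degrees are `≤ d`
(`d ≥ 1`), every finite family of `G`-connected sets of cardinality `s ≥ 1` containing the vertex `v` has
at most `C((d-1)s + 1, s-1)` members — the number of `0/1`-strings of length `d + (d-1)(s-1)` with `s-1`
ones, into which the family injects by `X ↦` (positions of the `true` bits of) its exploration code.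
(FGL18 Lemma 27 has the slightly smaller labelled-tree count `(d/((d-2)s+2))·C((d-1)s, s-1)`; this bound
still gives their Corollary 28, `|𝒞_s(𝒢)| ≤ |V|·C((d-1)s, s)`, after the symmetrisation `Σ_v |𝒞_s(v)| = s|𝒞_s(𝒢)|`.)
[cite: FawziGrospellierLeverrier2018, Lemma 27 / Cor 28 (§7.2, arXiv v2 p0019)] -/
theorem card_le_choose_of_isGraphConnected {d : ℕ} (hd : 1 ≤ d) (hdeg : ∀ x, G.degree x ≤ d) (v : V)
    {s : ℕ} (𝒜 : Finset (Finset V)) (h𝒜 : ∀ X ∈ 𝒜, IsGraphConnected G X ∧ X.card = s ∧ v ∈ X) :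
    𝒜.card ≤ ((d - 1) * s + 1).choose (s - 1) := by
  classical
  set L : ℕ := (d - 1) * s + 1 with hL
  set code : Finset V → List Bool := fun X => encode G d X s [(v, none)] {v} with hcode
  have hQ : QAdj (G := G) [(v, none)] := by
    intro e he p₀ hp₀
    rw [List.mem_singleton] at he
    subst he
    simp at hp₀
  have hspec : ∀ X ∈ 𝒜, replay G d s [(v, none)] {v} (code X ++ []) = X ∧
      (code X).length = L ∧ (code X).count true = s - 1 := by
    intro X hX
    obtain ⟨hconn, hcard, hvX⟩ := h𝒜 X hX
    have hφ : X.card + ([(v, none)] : List (V × Option V)).length ≤ s + ({v} : Finset V).card := by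
      simp [hcard]
    obtain ⟨h1, h2, h3⟩ := explore_spec hconn hdeg s [(v, none)] {v} (inv_init hvX) hφ
    refine ⟨?_, ?_, ?_⟩
    · rw [hcode, replay_encode hdeg X s [(v, none)] {v} [] hQ, h1]
    · simp only [List.map_cons, List.map_nil, List.sum_cons, List.sum_nil, add_zero, width,
        Finset.card_singleton, mul_one, hcard] at h2
      simp only [hcode, hL]
      obtain ⟨m, rfl⟩ : ∃ m, d = m + 1 := ⟨d - 1, by omega⟩
      simp only [Nat.add_sub_cancel] at h2 ⊢
      omega
    · simp only [Finset.card_singleton, hcard] at h3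
      simp only [hcode]
      omega
  have hmaps : ∀ X ∈ 𝒜, trueIdx (code X) 0 ∈ (Finset.range L).powersetCard (s - 1) := by
    intro X hX
    obtain ⟨_, lX, cX⟩ := hspec X hX
    rw [Finset.mem_powersetCard, card_trueIdx, cX]
    refine ⟨?_, rfl⟩
    have h := trueIdx_subset_Ico (code X) 0
    rwa [lX, zero_add, Nat.Ico_zero_eq_range] at h
  have hinj : Set.InjOn (fun X => trueIdx (code X) 0) 𝒜 := by
    intro X hX Y hY hXY
    obtain ⟨rX, lX, _⟩ := hspec X hX
    obtain ⟨rY, lY, _⟩ := hspec Y hY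
    have hc : code X = code Y := eq_of_trueIdx_eq _ _ 0 (by rw [lX, lY]) hXY
    rw [← rX, ← rY, hc]
  calc 𝒜.card ≤ ((Finset.range L).powersetCard (s - 1)).card :=
        Finset.card_le_card_of_injOn _ (fun X hX => hmaps X hX) hinj
    _ = L.choose (s - 1) := by rw [Finset.card_powersetCard, Finset.card_range]


end TreeCount

end Literature.Probability.LatticeModels
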